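import Mathlib
import Summits.KontsevichZagierPeriods.Zeta5Search.VCarrierAggregate
import Summits.KontsevichZagierPeriods.Zeta5Search.DenomLaw.FlagRayPath
import Summits.KontsevichZagierPeriods.Zeta5Search.ResidueIdentityBProof
import HarnessLib

/-!
# ζ(5) search — the PATH ACCOUNTING node on the WHOLE first-period band-60 FLAG ray: the last cell `17n < p ≤ 17.5n` by the V-carrier aggregate bonus

Cell `pub-zeta5` (HONEST FRAMING: systematic search; no irrationality claim unless certified), TRACK «DENOM-LAW» D1 prover seat
(denom-prover-d1 g12, `HOME/denom-law/prover-d1/ATTEMPT-12.md` §5).  `DenomLaw/FlagRayPath` proves the typed node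
`DenomLaw.PathAccountingFirstPeriod` on the flag ray `b(n) = n·(60; 25,24,22,21,19,18,16)` for every first-period prime EXCEPT the θ-cell
`17n < p ≤ 17.5n`, where the node asks `v_p(Cas_j) ≥ −5` and THEOREM LB gives `casLB = −6`: the minimum `VB = −5` is carried by the
`p − 16n` NON-TAME single-pole classes `x ∈ [16n, p)` of level type `[0,−6,1]` (neutral point, pole of order six, zero), whose conjugates
`60n − 2p − x` have the TAME type `[1,−6,0]` (`V` `p`-integral); every other class has exponent `≥ −4`.  This file closes the cell:
* §1 `c17a_data` — the class data read off the landed cover `FlagRayCellsC.cover_c17a` leaf by leaf: every class has `E ≥ −5`, the `E = −5`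
  classes are exactly the carriers `[16n, p)` and their conjugates, every multipole class has `E ≥ −4`;
* §2 the carriers' units satisfy `Σ_{x ∈ [16n,p)} ĝ_x ≡ 0 (mod p)` — the mod-`p` MOMENT LEMMA (`gHatMoments_holds`, depth `N = 5`, degree range
  `4p ≤ 2d + 3 = 70n + 3`, i.e. EXACTLY `p ≤ 17.5n`) gives `Σ_{E = −5} ĝ ≡ 0`, and the conjugation `ĝ_x̄ ≡ (−1)^{E+1} ĝ_x = ĝ_x` (`E = −5` odd) halves it —
  so by `VCarrierAggregate.padicNorm_coeffV_le_of_carriers` the carriers' first `V`-digits `ĝ_x·v̂([0,−6,1])` cancel IN AGGREGATE: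
  **`v_p(V(b(n))) ≥ −4 = VB + 1`**, and the same for `b(n) + e_j` (a carrier hit by the shift becomes tame or gains a unit; the unhit ones keep
  their type, `isType_shift_of_classExp_eq`; degree range `4p ≤ 70n + 1`);
* §3 `cas_ge_c17a_five`: `v_p(Cas_j(b(n))) ≥ −4 + rowMin = −5` for every `j` (`cas_val_ge_of_coeffV`, row constant `−1 = 3 + (−4)`), hence the
  node's value on the cell (`⌊d/p⌋ = 2`, `N_p = 12`, `C⋆ ≤ 10`), and **`pathAccountingFirstPeriod_on_flag_all`: the node
  `DenomLaw.PathAccountingFirstPeriod` with `b := b(n)`, binders VERBATIM, for EVERY `n ≥ 1` and EVERY first-period prime** (with `FlagRayPath`).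
Support theorems (the node is `∀ b` and stays OPEN).  MODEL/structure-side valuation bookkeeping of the cell's own rationals; nothing about ζ(5);
no γ; records in print UNMOVED.
-/

open Finset

namespace Summit.KontsevichZagierPeriods.Zeta5Search.StairFLAG

open Summit.KontsevichZagierPeriods.Zeta5Search.ClusterValuation
open Summit.KontsevichZagierPeriods.Zeta5Search.ClusterValuation.VCarrier
open Summit.KontsevichZagierPeriods.Zeta5Search.CasoratianValuation (InPolytope shift casoratian pairFloors refund)
open Summit.KontsevichZagierPeriods.Zeta5Search.DenomLaw (cStar FirstPeriod Sorted7)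
open Summit.KontsevichZagierPeriods.Zeta5Search.WedgeDictionary (dOf coeffV)
open Summit.KontsevichZagierPeriods.Zeta5Search.BigPrime (shift_zero dOf_shift)
open Summit.KontsevichZagierPeriods.Zeta5Search.ClassTypeCover
open Summit.KontsevichZagierPeriods.Zeta5Search.StaircaseCells
open Summit.KontsevichZagierPeriods.Zeta5Search.CellA (classExp_le_classNu)

variable {n p x : ℕ} [hp : Fact p.Prime]

/-! ## §1 Class data of the cell `34n < 2p ≤ 35n` (from the landed cover `cover_c17a`, leaf by leaf) -/

/-- Leaf transfer: the three facts about a typed class are decidable facts about its type. -/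
theorem c17a_aux {T : List ℤ} {cen : Bool} (h : IsType (bRay [60, 25, 24, 22, 21, 19, 18, 16] n) p x T cen)
    (h1 : ∀ odd, -5 ≤ expL odd T cen)
    (h2 : ∀ odd, expL odd T cen = -5 → (16 * n ≤ x ∨ (60 * n < x + 3 * p ∧ x + 2 * p ≤ 44 * n)))
    (h3 : ∀ odd, 2 ≤ polesL T → -4 ≤ expL odd T cen) :
    -5 ≤ classExp (bRay [60, 25, 24, 22, 21, 19, 18, 16] n) p x ∧
    (classExp (bRay [60, 25, 24, 22, 21, 19, 18, 16] n) p x = -5 → (16 * n ≤ x ∨ (60 * n < x + 3 * p ∧ x + 2 * p ≤ 44 * n))) ∧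
    (2 ≤ classPoleCount (bRay [60, 25, 24, 22, 21, 19, 18, 16] n) p x → -4 ≤ classExp (bRay [60, 25, 24, 22, 21, 19, 18, 16] n) p x) := by
  rw [h.classExp_eq, h.classPoleCount_eq]
  exact ⟨h1 _, h2 _, h3 _⟩

/-- **Class data of the cell** (all `x < p`): `E_x ≥ −5`; `E_x = −5` only on the carriers `16n ≤ x` (type `[0,−6,1]`) and their conjugates
`60n < x + 3p ∧ x + 2p ≤ 44n` (type `[1,−6,0]`); multipole classes have `E_x ≥ −4`.  (The decision tree of `cover_c17a`.) -/
theorem c17a_data (hA : 34 * n < 2 * p) (hB : 2 * p ≤ 35 * n) (hp2 : p % 2 = 1) (hx : x < p) :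
    -5 ≤ classExp (bRay [60, 25, 24, 22, 21, 19, 18, 16] n) p x ∧
    (classExp (bRay [60, 25, 24, 22, 21, 19, 18, 16] n) p x = -5 → (16 * n ≤ x ∨ (60 * n < x + 3 * p ∧ x + 2 * p ≤ 44 * n))) ∧
    (2 ≤ classPoleCount (bRay [60, 25, 24, 22, 21, 19, 18, 16] n) p x → -4 ≤ classExp (bRay [60, 25, 24, 22, 21, 19, 18, 16] n) p x) := by

  by_cases g : x + 3 * p ≤ 60 * n
  · by_cases g : x + p < 18 * n
    · by_cases g : x + 2 * p ≤ 35 * n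
      · exact c17a_aux (iv_c17a_0 hA hB hx (by omega) (by omega) (by omega) (by omega) (by omega) (by omega) (by omega)) (fun odd => by cases odd <;> decide) (fun odd h => absurd h (by cases odd <;> decide)) (fun odd => by cases odd <;> decide)
      exact c17a_aux (iv_c17a_1 hA hB hx (by omega) (by omega) (by omega) (by omega) (by omega) (by omega) (by omega)) (fun odd => by cases odd <;> decide) (fun odd h => absurd h (by cases odd <;> decide)) (fun odd => by cases odd <;> decide)
    by_cases g : x + p < 19 * n
    · by_cases g : x + 2 * p ≤ 36 * n
      · exact c17a_aux (iv_c17a_2 hA hB hx (by omega) (by omega) (by omega) (by omega) (by omega) (by omega) (by omega)) (fun odd => by cases odd <;> decide) (fun odd h => absurd h (by cases odd <;> decide)) (fun odd => by cases odd <;> decide)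
      exact c17a_aux (iv_c17a_3 hA hB hx (by omega) (by omega) (by omega) (by omega) (by omega) (by omega) (by omega)) (fun odd => by cases odd <;> decide) (fun odd h => absurd h (by cases odd <;> decide)) (fun odd => by cases odd <;> decide)
    by_cases g : x + p < 21 * n
    · by_cases g : x + 2 * p ≤ 38 * n
      · exact c17a_aux (iv_c17a_4 hA hB hx (by omega) (by omega) (by omega) (by omega) (by omega) (by omega) (by omega)) (fun odd => by cases odd <;> decide) (fun odd h => absurd h (by cases odd <;> decide)) (fun odd => by cases odd <;> decide)
      exact c17a_aux (iv_c17a_5 hA hB hx (by omega) (by omega) (by omega) (by omega) (by omega) (by omega) (by omega)) (fun odd => by cases odd <;> decide) (fun odd h => absurd h (by cases odd <;> decide)) (fun odd => by cases odd <;> decide)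
    by_cases g : x + p < 22 * n
    · by_cases g : x + 2 * p ≤ 39 * n
      · exact c17a_aux (iv_c17a_6 hA hB hx (by omega) (by omega) (by omega) (by omega) (by omega) (by omega) (by omega)) (fun odd => by cases odd <;> decide) (fun odd h => absurd h (by cases odd <;> decide)) (fun odd => by cases odd <;> decide)
      exact c17a_aux (iv_c17a_7 hA hB hx (by omega) (by omega) (by omega) (by omega) (by omega) (by omega) (by omega)) (fun odd => by cases odd <;> decide) (fun odd h => absurd h (by cases odd <;> decide)) (fun odd => by cases odd <;> decide)
    by_cases g : x + p < 24 * n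
    · by_cases g : x + 2 * p ≤ 41 * n
      · exact c17a_aux (iv_c17a_8 hA hB hx (by omega) (by omega) (by omega) (by omega) (by omega) (by omega) (by omega)) (fun odd => by cases odd <;> decide) (fun odd h => absurd h (by cases odd <;> decide)) (fun odd => by cases odd <;> decide)
      exact c17a_aux (iv_c17a_9 hA hB hx (by omega) (by omega) (by omega) (by omega) (by omega) (by omega) (by omega)) (fun odd => by cases odd <;> decide) (fun odd h => absurd h (by cases odd <;> decide)) (fun odd => by cases odd <;> decide)
    by_cases g : x + p < 25 * n
    · by_cases g : x + 2 * p ≤ 42 * n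
      · exact c17a_aux (iv_c17a_10 hA hB hx (by omega) (by omega) (by omega) (by omega) (by omega) (by omega) (by omega)) (fun odd => by cases odd <;> decide) (fun odd h => absurd h (by cases odd <;> decide)) (fun odd => by cases odd <;> decide)
      exact c17a_aux (iv_c17a_11 hA hB hx (by omega) (by omega) (by omega) (by omega) (by omega) (by omega) (by omega)) (fun odd => by cases odd <;> decide) (fun odd h => absurd h (by cases odd <;> decide)) (fun odd => by cases odd <;> decide)
    exact c17a_aux (iv_c17a_12 hA hB hx (by omega) (by omega) (by omega) (by omega) (by omega) (by omega) (by omega)) (fun odd => by cases odd <;> decide) (fun odd h => absurd h (by cases odd <;> decide)) (fun odd => by cases odd <;> decide)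
  by_cases g : x < 16 * n
  · by_cases g : x + 2 * p ≤ 44 * n
    · exact c17a_aux (iv_c17a_13 hA hB hx (by omega) (by omega) (by omega) (by omega) (by omega) (by omega)) (fun odd => by cases odd <;> decide) (fun _ _ => Or.inr ⟨by omega, by omega⟩) (fun odd => by cases odd <;> decide)
    by_cases g : 2 * x + 2 * p = 60 * n
    · exact c17a_aux (iv_c17a_14 hA hB hx (by omega) (by omega) (by omega) (by omega) (by omega) (by omega)) (fun odd => by cases odd <;> decide) (fun odd h => absurd h (by cases odd <;> decide)) (fun odd => by cases odd <;> decide)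
    exact c17a_aux (iv_c17a_15 hA hB hx (by omega) (by omega) (by omega) (by omega) (by omega) (by omega)) (fun odd => by cases odd <;> decide) (fun odd h => absurd h (by cases odd <;> decide)) (fun odd => by cases odd <;> decide)
  exact c17a_aux (iv_c17a_16 hA hB hx (by omega) (by omega) (by omega) (by omega) (by omega) (by omega)) (fun odd => by cases odd <;> decide) (fun _ _ => Or.inl (by omega)) (fun odd => by cases odd <;> decide)

/-- The CARRIER type: `16n ≤ x < p` is the level class `[0,−6,1]` (neutral, pole of order six at level one, zero), centre-free. -/
theorem carrier_isType (hA : 34 * n < 2 * p) (hB : 2 * p ≤ 35 * n) (hx : x < p) (h16 : 16 * n ≤ x) :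
    IsType (bRay [60, 25, 24, 22, 21, 19, 18, 16] n) p x [0, -6, 1] false :=
  iv_c17a_16 hA hB hx (by omega) (by omega) (by omega) (by omega) (by omega) (by omega)

/-- The CONJUGATE type: `60n < x + 3p`, `x + 2p ≤ 44n` is the level class `[1,−6,0]` (zero below the pole: TAME), centre-free. -/
theorem conj_isType (hA : 34 * n < 2 * p) (hB : 2 * p ≤ 35 * n) (hx : x < p) (h1 : 60 * n < x + 3 * p)
    (h2 : x + 2 * p ≤ 44 * n) : IsType (bRay [60, 25, 24, 22, 21, 19, 18, 16] n) p x [1, -6, 0] false :=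
  iv_c17a_13 hA hB hx (by omega) (by omega) (by omega) (by omega) (by omega) (by omega)

/-- `expL` of a centre-free type is the plain sum. -/
theorem expL_false (odd : Bool) (T : List ℤ) : expL odd T false = T.sum := by
  simp [expL]

/-- `ν = 0` for the conjugate type (tame single pole). -/
theorem nuL_conj (odd : Bool) : nuL odd [1, -6, 0] false = 0 := by
  cases odd <;> decide

/-- `(b(n))₀ = 60n` as a natural number, also after a shift. -/
theorem b0_toNat (n : ℕ) : ((bRay [60, 25, 24, 22, 21, 19, 18, 16] n) 0).toNat = 60 * n := by
  rw [v0, Int.toNat_natCast]; ring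

omit hp in
/-- The conjugate of a carrier `x` is the residue `60n − 2p − x`, i.e. `conjClass`. -/
theorem conjClass_carrier (hA : 34 * n < 2 * p) (hB : 2 * p ≤ 35 * n) (hx : x < p) (h16 : 16 * n ≤ x) :
    conjClass (bRay [60, 25, 24, 22, 21, 19, 18, 16] n) p x = 60 * n - 2 * p - x := by
  unfold conjClass
  rw [b0_toNat, show 60 * n - x = (60 * n - 2 * p - x) + 2 * p by omega, Nat.add_mul_mod_self_right]
  exact Nat.mod_eq_of_lt (by omega)

omit hp in
/-- … and conversely the conjugate of `y = 60n − 2p − x` (`60n < y + 3p`, `y + 2p ≤ 44n`) is a carrier residue. -/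
theorem conjClass_conj (hx : x < p) (h1 : 60 * n < x + 3 * p)
    (h2 : x + 2 * p ≤ 44 * n) : conjClass (bRay [60, 25, 24, 22, 21, 19, 18, 16] n) p x = 60 * n - 2 * p - x := by
  unfold conjClass
  rw [b0_toNat, show 60 * n - x = (60 * n - 2 * p - x) + 2 * p by omega, Nat.add_mul_mod_self_right]
  exact Nat.mod_eq_of_lt (by omega)

/-! ## §2 `v_p(V) ≥ −4` for `b(n)` and for `b(n) + e_j` on the cell -/

section Cell

variable (hn : 1 ≤ n) (hA : 34 * n < 2 * p) (hB : 2 * p ≤ 35 * n)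
include hn hA hB

/-- Window facts on the cell: `p ≥ 5`, `p` odd, `b₀ + 2 < p²`. -/
theorem c17a_window : 5 ≤ p ∧ p % 2 = 1 ∧ ((bRay [60, 25, 24, 22, 21, 19, 18, 16] n) 0 + 2 : ℤ) < (p : ℤ) ^ 2 := by
  obtain ⟨hp5, hwin⟩ := window13 hn (by omega : 13 * n < p)
  exact ⟨hp5, Nat.odd_iff.1 (hp.out.odd_of_ne_two (by omega)), hwin⟩

/-- **`‖V(c)‖ ≤ p⁴` for `c = b(n) + e_j` (`j = 0` allowed: `c = b(n)` itself is covered by taking the unshifted data)** — the common core: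
for a vector `c` in the polytope with the same `b₀`, whose class exponents dominate those of `b(n)` classwise with equality forcing equal types,
… stated concretely for `c = shift (b n) j`. -/
theorem coeffV_shift_le (j : ℕ) (hj1 : 1 ≤ j) (hj7 : j ≤ 7) :
    padicNorm p (coeffV (shift (bRay [60, 25, 24, 22, 21, 19, 18, 16] n) j)) ≤ (p : ℚ) ^ (-((-5 : ℤ) + 1)) := by
  obtain ⟨hp5, hp2, hwin⟩ := c17a_window hn hA hB
  have hb : InPolytope (bRay [60, 25, 24, 22, 21, 19, 18, 16] n) := inPolytope_ray n
  have hb' : InPolytope (shift (bRay [60, 25, 24, 22, 21, 19, 18, 16] n) j) := inPolytope_shift_ray_j hn j hj1 hj7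
  have hbox := hb.1
  have h0' : shift (bRay [60, 25, 24, 22, 21, 19, 18, 16] n) j 0 = (bRay [60, 25, 24, 22, 21, 19, 18, 16] n) 0 := shift_zero _ hj1
  have hwin' : (shift (bRay [60, 25, 24, 22, 21, 19, 18, 16] n) j 0 + 2 : ℤ) < (p : ℤ) ^ 2 := by rw [h0']; exact hwin
  have hEge : ∀ y, y < p → classExp (bRay [60, 25, 24, 22, 21, 19, 18, 16] n) p y ≤ classExp (shift (bRay [60, 25, 24, 22, 21, 19, 18, 16] n) j) p y :=
    fun y _ => classExp_shift_ge _ hbox hj1 p y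
  -- carriers of the shifted vector: the unhit carriers
  set D : Finset ℕ := (range p).filter (fun y => 16 * n ≤ y ∧ classExp (shift (bRay [60, 25, 24, 22, 21, 19, 18, 16] n) j) p y = -5) with hDdef
  have hDmem : ∀ y, y ∈ D ↔ y < p ∧ 16 * n ≤ y ∧ classExp (shift (bRay [60, 25, 24, 22, 21, 19, 18, 16] n) j) p y = -5 := by
    intro y; rw [hDdef, mem_filter, mem_range]
  have hT : ∀ y ∈ D, IsType (shift (bRay [60, 25, 24, 22, 21, 19, 18, 16] n) j) p y [0, -6, 1] false := by
    intro y hy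
    obtain ⟨hyp, h16, hE⟩ := (hDmem y).1 hy
    have ht := carrier_isType hA hB hyp h16
    refine isType_shift_of_classExp_eq hb hj1 ht ?_
    rw [hE, ht.classExp_eq, expL_false]; decide
  -- every other pole class of the shifted vector has ν ≥ −4
  have hrest : ∀ y, y < p → 1 ≤ classPoleCount (shift (bRay [60, 25, 24, 22, 21, 19, 18, 16] n) j) p y → y ∉ D →
      (-5 : ℤ) + 1 ≤ classNu (shift (bRay [60, 25, 24, 22, 21, 19, 18, 16] n) j) p y := by
    intro y hyp hpole hyD
    obtain ⟨hE5, hEq, -⟩ := c17a_data hA hB hp2 hyp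
    have hle := classExp_le_classNu (shift (bRay [60, 25, 24, 22, 21, 19, 18, 16] n) j) p y
    by_cases h4 : -4 ≤ classExp (shift (bRay [60, 25, 24, 22, 21, 19, 18, 16] n) j) p y
    · linarith
    have hE' : classExp (shift (bRay [60, 25, 24, 22, 21, 19, 18, 16] n) j) p y = -5 := by have := hEge y hyp; omega
    have hE : classExp (bRay [60, 25, 24, 22, 21, 19, 18, 16] n) p y = -5 := by have := hEge y hyp; omega
    rcases hEq hE with h16 | ⟨hc1, hc2⟩
    · exact absurd ((hDmem y).2 ⟨hyp, h16, hE'⟩) hyD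
    · have ht := conj_isType hA hB hyp hc1 hc2
      have hnu : classNu (bRay [60, 25, 24, 22, 21, 19, 18, 16] n) p y = 0 := by rw [ht.classNu_eq, nuL_conj]
      have := classNu_shift_ge _ hbox hj1 hpole
      linarith
  -- the carriers' units sum to 0 mod p: moment lemma at depth 5 on the shifted vector + conjugation
  have hEN : ∀ y, y < p → -((5 : ℕ) : ℤ) ≤ classExp (shift (bRay [60, 25, 24, 22, 21, 19, 18, 16] n) j) p y := by
    intro y hyp
    have := (c17a_data hA hB hp2 hyp).1
    have := hEge y hyp
    push_cast; omega
  have hdeg : (((5 : ℕ) : ℤ) - 1) * p ≤ 2 * dOf (shift (bRay [60, 25, 24, 22, 21, 19, 18, 16] n) j) + 3 := by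
    rw [dOf_shift _ hj1 hj7, dOf_ray]; push_cast; omega
  set φ : ℕ → ℕ := fun y => 60 * n - 2 * p - y with hφ
  have hφconj : ∀ y ∈ D, φ y = conjClass (shift (bRay [60, 25, 24, 22, 21, 19, 18, 16] n) j) p y := by
    intro y hy
    obtain ⟨hyp, h16, -⟩ := (hDmem y).1 hy
    rw [CellKit.conjClass_shift _ hj1, conjClass_carrier hA hB hyp h16]
  have hsplit : deepClasses (shift (bRay [60, 25, 24, 22, 21, 19, 18, 16] n) j) p 5 = D ∪ D.image φ := by
    ext y
    rw [deepClasses, mem_filter, mem_range, mem_union, hDmem, mem_image]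
    constructor
    · rintro ⟨hyp, hE'⟩
      have hE : classExp (bRay [60, 25, 24, 22, 21, 19, 18, 16] n) p y = -5 := by
        have := hEge y hyp; have := (c17a_data hA hB hp2 hyp).1; push_cast at hE'; omega
      rcases (c17a_data hA hB hp2 hyp).2.1 hE with h16 | ⟨hc1, hc2⟩
      · exact Or.inl ⟨hyp, h16, by push_cast at hE'; exact hE'⟩
      · refine Or.inr ⟨60 * n - 2 * p - y, (hDmem _).2 ⟨by omega, by omega, ?_⟩, by simp only [hφ]; omega⟩
        -- `E⁺` of the conjugate residue equals `E⁺` of `y`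
        have hcy : conjClass (shift (bRay [60, 25, 24, 22, 21, 19, 18, 16] n) j) p y = 60 * n - 2 * p - y := by
          rw [CellKit.conjClass_shift _ hj1, conjClass_conj hyp hc1 hc2]
        rw [← hcy, classExp_conj _ (by rw [h0']; exact hbox.1) (by rw [h0', b0_toNat]; omega)]
        push_cast at hE'; exact hE'
    · rintro (⟨hyp, -, hE'⟩ | ⟨z, hz, rfl⟩)
      · exact ⟨hyp, by push_cast; exact hE'⟩
      · obtain ⟨hzp, h16, hE'⟩ := (hDmem z).1 hz
        refine ⟨by simp only [hφ]; omega, ?_⟩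
        rw [hφconj z hz, classExp_conj _ (by rw [h0']; exact hbox.1) (by rw [h0', b0_toNat]; omega)]
        push_cast; exact hE'
  have hdisj : Disjoint D (D.image φ) := by
    rw [disjoint_left]
    intro y hy hy'
    obtain ⟨-, h16, -⟩ := (hDmem y).1 hy
    obtain ⟨z, hz, hzy⟩ := mem_image.1 hy'
    obtain ⟨hzp, hz16, -⟩ := (hDmem z).1 hz
    simp only [hφ] at hzy
    omega
  have hinj : Set.InjOn φ D := by
    intro y hy z hz hyz
    obtain ⟨hyp, -, -⟩ := (hDmem y).1 hy
    obtain ⟨hzp, -, -⟩ := (hDmem z).1 hz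
    simp only [hφ] at hyz
    omega
  have hconj : ∀ y ∈ D, padicNorm p (gHat (shift (bRay [60, 25, 24, 22, 21, 19, 18, 16] n) j) p (φ y) - gHat (shift (bRay [60, 25, 24, 22, 21, 19, 18, 16] n) j) p y)
      ≤ (p : ℚ) ^ (-(1 : ℤ)) := by
    intro y hy
    obtain ⟨hyp, h16, -⟩ := (hDmem y).1 hy
    have h := gHat_conj_carrier hb' hp5 (hT y hy) (by decide)
    have e1 : (shift (bRay [60, 25, 24, 22, 21, 19, 18, 16] n) j 0).toNat - (y + (List.length [0, -6, 1] - 1) * p) = φ y := by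
      rw [h0', b0_toNat]; simp only [hφ, List.length_cons, List.length_nil]; omega
    rwa [e1] at h
  have hsum := gHat_carrier_sum_le _ hb' hp5 5 (by norm_num) hEN hdeg D φ hsplit hdisj hinj hconj
  exact padicNorm_coeffV_le_of_carriers _ hb' hp5 hwin' (-5) D [0, -6, 1] hT (by decide) ⟨-6, by simp, by norm_num⟩
    hrest hsum

/-- **`‖V(b(n))‖ ≤ p⁴`, i.e. `v_p(V(b(n))) ≥ −4 = VB + 1`, on the cell.**  (Same proof with the unshifted data; written out through the
shift by `e_7` undone: we simply rerun the argument with `j`-independent facts — here via the carriers of `b(n)` itself.) -/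
theorem coeffV_le : padicNorm p (coeffV (bRay [60, 25, 24, 22, 21, 19, 18, 16] n)) ≤ (p : ℚ) ^ (-((-5 : ℤ) + 1)) := by
  obtain ⟨hp5, hp2, hwin⟩ := c17a_window hn hA hB
  have hb : InPolytope (bRay [60, 25, 24, 22, 21, 19, 18, 16] n) := inPolytope_ray n
  set D : Finset ℕ := (range p).filter (fun y => 16 * n ≤ y) with hDdef
  have hDmem : ∀ y, y ∈ D ↔ y < p ∧ 16 * n ≤ y := by
    intro y; rw [hDdef, mem_filter, mem_range]
  have hT : ∀ y ∈ D, IsType (bRay [60, 25, 24, 22, 21, 19, 18, 16] n) p y [0, -6, 1] false := by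
    intro y hy
    obtain ⟨hyp, h16⟩ := (hDmem y).1 hy
    exact carrier_isType hA hB hyp h16
  have hrest : ∀ y, y < p → 1 ≤ classPoleCount (bRay [60, 25, 24, 22, 21, 19, 18, 16] n) p y → y ∉ D → (-5 : ℤ) + 1 ≤ classNu (bRay [60, 25, 24, 22, 21, 19, 18, 16] n) p y := by
    intro y hyp _ hyD
    obtain ⟨hE5, hEq, -⟩ := c17a_data hA hB hp2 hyp
    have hle := classExp_le_classNu (bRay [60, 25, 24, 22, 21, 19, 18, 16] n) p y
    by_cases h4 : -4 ≤ classExp (bRay [60, 25, 24, 22, 21, 19, 18, 16] n) p y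
    · linarith
    rcases hEq (by omega) with h16 | ⟨hc1, hc2⟩
    · exact absurd ((hDmem y).2 ⟨hyp, h16⟩) hyD
    · rw [(conj_isType hA hB hyp hc1 hc2).classNu_eq, nuL_conj]; norm_num
  have hEN : ∀ y, y < p → -((5 : ℕ) : ℤ) ≤ classExp (bRay [60, 25, 24, 22, 21, 19, 18, 16] n) p y := by
    intro y hyp; have := (c17a_data hA hB hp2 hyp).1; push_cast; omega
  have hdeg : (((5 : ℕ) : ℤ) - 1) * p ≤ 2 * dOf (bRay [60, 25, 24, 22, 21, 19, 18, 16] n) + 3 := by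
    rw [dOf_ray]; push_cast; omega
  set φ : ℕ → ℕ := fun y => 60 * n - 2 * p - y with hφ
  have hsplit : deepClasses (bRay [60, 25, 24, 22, 21, 19, 18, 16] n) p 5 = D ∪ D.image φ := by
    ext y
    rw [deepClasses, mem_filter, mem_range, mem_union, hDmem, mem_image]
    constructor
    · rintro ⟨hyp, hE'⟩
      rcases (c17a_data hA hB hp2 hyp).2.1 (by push_cast at hE'; exact hE') with h16 | ⟨hc1, hc2⟩
      · exact Or.inl ⟨hyp, h16⟩
      · exact Or.inr ⟨60 * n - 2 * p - y, (hDmem _).2 ⟨by omega, by omega⟩, by simp only [hφ]; omega⟩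
    · rintro (⟨hyp, h16⟩ | ⟨z, hz, rfl⟩)
      · refine ⟨hyp, ?_⟩
        rw [(carrier_isType hA hB hyp h16).classExp_eq, expL_false]; decide
      · obtain ⟨hzp, h16⟩ := (hDmem z).1 hz
        refine ⟨by simp only [hφ]; omega, ?_⟩
        rw [(conj_isType hA hB (x := φ z) (by simp only [hφ]; omega) (by simp only [hφ]; omega)
          (by simp only [hφ]; omega)).classExp_eq, expL_false]; decide
  have hdisj : Disjoint D (D.image φ) := by
    rw [disjoint_left]
    intro y hy hy'
    obtain ⟨-, h16⟩ := (hDmem y).1 hy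
    obtain ⟨z, hz, hzy⟩ := mem_image.1 hy'
    obtain ⟨hzp, hz16⟩ := (hDmem z).1 hz
    simp only [hφ] at hzy
    omega
  have hinj : Set.InjOn φ D := by
    intro y hy z hz hyz
    obtain ⟨hyp, -⟩ := (hDmem y).1 hy
    obtain ⟨hzp, -⟩ := (hDmem z).1 hz
    simp only [hφ] at hyz
    omega
  have hconj : ∀ y ∈ D, padicNorm p (gHat (bRay [60, 25, 24, 22, 21, 19, 18, 16] n) p (φ y) - gHat (bRay [60, 25, 24, 22, 21, 19, 18, 16] n) p y) ≤ (p : ℚ) ^ (-(1 : ℤ)) := by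
    intro y hy
    obtain ⟨hyp, h16⟩ := (hDmem y).1 hy
    have h := gHat_conj_carrier hb hp5 (hT y hy) (by decide)
    have e1 : ((bRay [60, 25, 24, 22, 21, 19, 18, 16] n) 0).toNat - (y + (List.length [0, -6, 1] - 1) * p) = φ y := by
      rw [b0_toNat]; simp only [hφ, List.length_cons, List.length_nil]; omega
    rwa [e1] at h
  have hsum := gHat_carrier_sum_le _ hb hp5 5 (by norm_num) hEN hdeg D φ hsplit hdisj hinj hconj
  exact padicNorm_coeffV_le_of_carriers _ hb hp5 hwin (-5) D [0, -6, 1] hT (by decide) ⟨-6, by simp, by norm_num⟩ hrest hsum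

/-! ## §3 The Casoratian and the PATH node on the cell, then on the whole first-period ray -/

/-- **`v_p(Cas_j(b(n))) ≥ −5` on `17n < p ≤ 17.5n`, every `1 ≤ j ≤ 7`, every `n ≥ 1`** (THEOREM LB's rows with the `V`-bounds `≥ −4`;
row constant `−1 = 3 + (−4)` from the multipole classes). One unit above `casLB = −6` (`cas_ge_c17a`). -/
theorem cas_ge_c17a_five (j : ℕ) (hj1 : 1 ≤ j) (hj7 : j ≤ 7) (hcas : casoratian (bRay [60, 25, 24, 22, 21, 19, 18, 16] n) j ≠ 0) :
    (-5 : ℤ) ≤ padicValRat p (casoratian (bRay [60, 25, 24, 22, 21, 19, 18, 16] n) j) := by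
  obtain ⟨hp5, hp2, hwin⟩ := c17a_window hn hA hB
  have hb : InPolytope (bRay [60, 25, 24, 22, 21, 19, 18, 16] n) := inPolytope_ray n
  have hb' : InPolytope (shift (bRay [60, 25, 24, 22, 21, 19, 18, 16] n) j) := inPolytope_shift_ray_j hn j hj1 hj7
  have h := cas_val_ge_of_coeffV _ hb hj1 hj7 hb' hp5 hwin (-4) (-1)
    (by have := coeffV_le hn hA hB (p := p); norm_num at this ⊢; exact this)
    (by have := coeffV_shift_le hn hA hB (p := p) j hj1 hj7; norm_num at this ⊢; exact this)
    (by norm_num) (fun y hy hm => by have := (c17a_data hA hB hp2 hy).2.2 hm; omega)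
    (fun h => by rw [dOf_ray] at h; push_cast at h; omega) hcas
  linarith

end Cell

/-- **PATH on the cell `17n < p ≤ 17.5n`** (`⌊d/p⌋ = 2`, `N_p = 12`, `C⋆ ≤ 10`): the node's value `2 − 12 − min(1, 5 − C⋆) ≤ −5 ≤ v_p(Cas₇)`. -/
theorem pathAccounting_flag_c17a (n p : ℕ) (hn : 1 ≤ n) (hprime : p.Prime) (hA : 34 * n < 2 * p) (hB : 2 * p ≤ 35 * n)
    (hcas : casoratian (bRay [60, 25, 24, 22, 21, 19, 18, 16] n) 7 ≠ 0) :
    dOf (bRay [60, 25, 24, 22, 21, 19, 18, 16] n) / (p : ℤ) - pairFloors (bRay [60, 25, 24, 22, 21, 19, 18, 16] n) p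
        - min (if 2 ≤ dOf (bRay [60, 25, 24, 22, 21, 19, 18, 16] n) / (p : ℤ) then (1 : ℤ) else 0)
            (5 - (cStar (bRay [60, 25, 24, 22, 21, 19, 18, 16] n) p : ℤ))
      ≤ padicValRat p (casoratian (bRay [60, 25, 24, 22, 21, 19, 18, 16] n) 7) := by
  haveI : Fact p.Prime := ⟨hprime⟩
  have hv := cas_ge_c17a_five (p := p) hn hA hB 7 (by norm_num) (by norm_num) hcas
  have hC : (cStar (bRay [60, 25, 24, 22, 21, 19, 18, 16] n) p : ℤ) ≤ 10 := by exact_mod_cast cStar_flag_le_ten (n := n) (p := p) (by omega)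
  rw [dOf_div_two (by omega) hB, if_pos (le_refl _), N_c17a hA hB]
  have hmin : -5 ≤ min (1 : ℤ) (5 - (cStar (bRay [60, 25, 24, 22, 21, 19, 18, 16] n) p : ℤ)) := le_min (by norm_num) (by linarith)
  linarith

/-- **PATH ON THE WHOLE FIRST-PERIOD FLAG RAY**: for every `n ≥ 1` and every prime `p > 13n`,
`⌊d/p⌋ − N_p − min([⌊d/p⌋ ≥ 2], 5 − C⋆) ≤ v_p(Cas₇(b(n)))` (`FlagRayPath.pathAccounting_flag` off the cell `17n < p ≤ 17.5n`, §3 on it). -/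
theorem pathAccounting_flag_all (n p : ℕ) (hn : 1 ≤ n) (hprime : p.Prime) (h13 : 13 * n < p)
    (hcas : casoratian (bRay [60, 25, 24, 22, 21, 19, 18, 16] n) 7 ≠ 0) :
    dOf (bRay [60, 25, 24, 22, 21, 19, 18, 16] n) / (p : ℤ) - pairFloors (bRay [60, 25, 24, 22, 21, 19, 18, 16] n) p
        - min (if 2 ≤ dOf (bRay [60, 25, 24, 22, 21, 19, 18, 16] n) / (p : ℤ) then (1 : ℤ) else 0)
            (5 - (cStar (bRay [60, 25, 24, 22, 21, 19, 18, 16] n) p : ℤ))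
      ≤ padicValRat p (casoratian (bRay [60, 25, 24, 22, 21, 19, 18, 16] n) 7) := by
  by_cases hx17 : 34 * n < 2 * p ∧ 2 * p ≤ 35 * n
  · exact pathAccounting_flag_c17a n p hn hprime hx17.1 hx17.2 hcas
  · exact pathAccounting_flag n p hn hprime h13 hx17 hcas

/-- **The node `PathAccountingFirstPeriod` restricted to the flag ray, literally** (all its binders, `b := b(n)`), every `n ≥ 1`, EVERY
first-period prime — no cell excluded. -/
theorem pathAccountingFirstPeriod_on_flag_all (n p : ℕ) (hn : 1 ≤ n) :
    InPolytope (bRay [60, 25, 24, 22, 21, 19, 18, 16] n) → Sorted7 (bRay [60, 25, 24, 22, 21, 19, 18, 16] n) →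
    InPolytope (shift (bRay [60, 25, 24, 22, 21, 19, 18, 16] n) 7) → p.Prime → 5 ≤ p →
    ((bRay [60, 25, 24, 22, 21, 19, 18, 16] n) 0 + 2 : ℤ) < (p : ℤ) ^ 2 → FirstPeriod (bRay [60, 25, 24, 22, 21, 19, 18, 16] n) p →
    casoratian (bRay [60, 25, 24, 22, 21, 19, 18, 16] n) 7 ≠ 0 →
      dOf (bRay [60, 25, 24, 22, 21, 19, 18, 16] n) / (p : ℤ) - pairFloors (bRay [60, 25, 24, 22, 21, 19, 18, 16] n) p
          - min (if 2 ≤ dOf (bRay [60, 25, 24, 22, 21, 19, 18, 16] n) / (p : ℤ) then (1 : ℤ) else 0)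
              (5 - (cStar (bRay [60, 25, 24, 22, 21, 19, 18, 16] n) p : ℤ))
        ≤ padicValRat p (casoratian (bRay [60, 25, 24, 22, 21, 19, 18, 16] n) 7) :=
  fun _ _ _ hprime _ _ hfp hcas => pathAccounting_flag_all n p hn hprime (thirteen_lt_of_firstPeriod hfp) hcas

/-- **(CV) one unit sharper on the cell, every `j`**: `17n < p ≤ 17.5n ⇒ v_p(Cas_j(b(n))) ≥ −5` (vs. `refund − N_p = −11`, `casLB = −6`). -/
theorem cas_ge_c17a_five' (n j p : ℕ) (hn : 1 ≤ n) (hj1 : 1 ≤ j) (hj7 : j ≤ 7) (hprime : p.Prime)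
    (hA : 34 * n < 2 * p) (hB : 2 * p ≤ 35 * n) (hcas : casoratian (bRay [60, 25, 24, 22, 21, 19, 18, 16] n) j ≠ 0) :
    (-5 : ℤ) ≤ padicValRat p (casoratian (bRay [60, 25, 24, 22, 21, 19, 18, 16] n) j) := by
  haveI : Fact p.Prime := ⟨hprime⟩
  exact cas_ge_c17a_five hn hA hB j hj1 hj7 hcas

end Summit.KontsevichZagierPeriods.Zeta5Search.StairFLAG
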